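import Literature.NumberTheory.EllipticCurves.TianYuanZhang2017.ScriptLOddOfRhoZero
import Literature.NumberTheory.EllipticCurves.TianYuanZhang2017.GenusFieldFamily
import Literature.NumberTheory.EllipticCurves.HeathBrown1994.CongruentTwoSelmerMonskyMatrix
import HarnessLib

/-!
# Sub-lane «bsd-p2»: the GENUS CONDITION of Tian–Yuan–Zhang Thm 1.2, KERNEL-DECIDABLE per `n` —
# `Σ₁, Σ₂ (mod 2)` for the concrete fields `K_d = GenusField d` from Rédei kernels on `{i // pᵢ ∣ d}`
# (input (H4) of door D-CN-6; p2-lead QUEUE v3 (ii), L1-29 / L1-30; design note p2/LIT-STATUS.md T1-M19 / T1-M21)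

HONEST FRAMING (sub-lane «bsd-p2», run/shared/lean/b2b/bsd-rank1-residual/p2/, verbatim in every
file): the target of record is the FULL Birch–Swinnerton-Dyer formula for EVERY analytic-rank `≤ 1`
`E/ℚ` at ALL primes INCLUDING `2`; the odd-prime class ledger is referee A's; the `2`-part is OPEN
(cells O1 = X5 ∖ CM and O12 = the CM corner) and under census by «bsd-p2». Census / instrument
output at `2` = EVIDENCE / conjecture items with held-out validation, NEVER a Literature fact;
certificates close PAIRS (one isogeny class, `p = 2`), never classes. This file asserts NO
arithmetic fact. WHAT IT DOES. Tian–Yuan–Zhang 2017 Thm 1.2 (typed AS PRINTED by p2-lit-1,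
`thm12_parity_of_scriptL`; consequences at `ρ(n) = 0` in `ScriptLOddOfRhoZero.lean`, p322630) is
quantified over a family of quadratic fields `K_d ∋ √−d`, `d ∣ n`, through the genus class numbers
`g(d) = #2Cl(K_d)` entering the sums `Σ₁(n; g)`, `Σ₂(n; g)`; lit-1's `GenusField d = ℚ[X]/(X² + d)`
(p323102) is a CONCRETE such family. Here the hypothesis "`Σ₁` odd or `Σ₂` odd" for `GenusField` is
made DECIDABLE BY ONE `decide` PER `n`, modulo the displayed Rédei–Reichardt fact (`hR`,
`redeiReichardt_fourTwoCard_classGroup`, Li–Ma 2008 Thm 0.4, p319707): (§1) Rédei's matrix may be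
written on ANY finite index type `ι` carrying an injective prime family (reindexing
`odd_genusClassNumber_iff_of_redeiReichardt` + `card_ker_mulVec_eq` along `ι ≃ Fin #ι`): `g(d)` is odd
iff that matrix has a `2`-element kernel; (§2) for `n = p₁⋯p_k` (the instance's prime tuple `p`, the
same tuple Monsky's matrix is built from) and `d ∣ n`, take `ι = {i // pᵢ ∣ d}` (`d ≢ 1 (mod 4)`,
`D = −d`) or `ι = Option {i // pᵢ ∣ d}` with `none ↦ 2` (`d ≡ 1 (mod 4)`, `D = −4d`, Li–Ma Lemma 0.1):
`genusClassNumber_genusField_mod_two_eq` writes `g(d) mod 2` as a closed `0/1` term in `p` and `d`, and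
`odd_genusSum_genusField_iff` transfers the parity of `Σ₁, Σ₂` (lit-1's `odd_genusSum₁/₂_iff_of_mod_two_eq`)
to that term — whose genus sums EVALUATE in the kernel (`decompositions`, `genusSum₁/₂` are
computable; checked: `n = 255` decides in seconds). No per-divisor bookkeeping, no table of `g(d)`
displayed: the door D-CN-6 (`P2/CongruentNumberPairsAtTwoRankOneGenus.lean`) takes the `GenusField`
form and an instance discharges it by `(odd_genusSum_genusField_iff …).1.mpr (by decide)`.
Nothing booked; no mark moved. Unit `b2b-bsdres-p2-typer` GEN 4; NEW file. RE-KEY (append §3, T-81/T-84):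
`odd_genusSum₂'_genusField_iff` decides the PRINTED second sum `genusSum₂'` (ERRATUM F-Σ2) the same way.

References: [LiMa2008] Y. Li, L. Ma, Acta Arith. 134 (2008), Lemma 0.1, Def 0.2, Thm 0.4
(Rédei–Reichardt); [TianYuanZhang2017] Thm 1.2, §1 (`g(d)`, `Σ₁`, `Σ₂`); [HardyWright2008] §17.8;
HOME/p2/LIT-STATUS.md T1-M19 (H4), T1-M21; HOME/p2/LEAD-OKS.md L1-29, L1-30.
-/

noncomputable section

open scoped Classical

open Matrix Finset NumberField Literature.NumberTheory.EllipticCurves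
  Literature.NumberTheory.EllipticCurves.HeathBrown1994
  Literature.NumberTheory.EllipticCurves.TianYuanZhang2017
  Literature.NumberTheory.QuadraticFields.RedeiReichardt

set_option autoImplicit false

namespace Summit.BirchSwinnertonDyer.Rank1Residual.P2

/-! ## §1 Rédei on an arbitrary finite index type -/

section GenusSide

/-- **Rédei on an arbitrary index type.** Modulo Rédei–Reichardt (`hR`): for an injective family
`q : ι → primes` with `∏ q = d` (`d ≢ 1 (mod 4)`) resp. `= 2d` (`d ≡ 1 (mod 4)`), `g(d) =
#2Cl(K_d)` (`K_d = GenusField d`) is ODD iff the Rédei matrix written on `ι` — `r_ab = [(D_{q b}/q a) = −1]`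
off the diagonal, row sums on it — has a `2`-element kernel (`r₄ = 0`). Reindexing by
`ι ≃ Fin #ι` reduces to `odd_genusClassNumber_iff_of_redeiReichardt` and `card_ker_mulVec_eq`.
[cite: LiMa2008, Thm. 0.4 (p. 280) with Def. 0.2 (p. 279)] [cite: TianYuanZhang2017, §1 (p0002 L78–L82: g(d))] -/
theorem odd_genusClassNumber_genusField_iff_card_ker (hR : redeiReichardt_fourTwoCard_classGroup)
    {ι : Type} [Fintype ι] [DecidableEq ι] (q : ι → ℕ) (hq : ∀ a, (q a).Prime)
    (hinj : Function.Injective q) {d : ℕ} (hprod : ∏ a, q a = if d % 4 = 1 then 2 * d else d) :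
    Odd (genusClassNumber (GenusField d)) ↔
      Fintype.card {v : ι → ZMod 2 // (Matrix.of fun a b : ι =>
        if a = b then ∑ c ∈ univ.erase a, kroneckerBit (primeDisc d (q c)) (q a)
        else kroneckerBit (primeDisc d (q b)) (q a)) *ᵥ v = 0} = 2 := by
  set e : Fin (Fintype.card ι) ≃ ι := (Fintype.equivFin ι).symm with he
  set R : Matrix ι ι (ZMod 2) := Matrix.of fun a b : ι =>
    if a = b then ∑ c ∈ univ.erase a, kroneckerBit (primeDisc d (q c)) (q a)
    else kroneckerBit (primeDisc d (q b)) (q a) with hRdef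
  -- the tuple on `Fin t` and its Rédei matrix = the reindexed `R`
  have hsub : redeiMatrix d (q ∘ e) = R.submatrix e e := by
    ext i j
    simp only [redeiMatrix, hRdef, Matrix.submatrix_apply, Matrix.of_apply, Function.comp_apply,
      EmbeddingLike.apply_eq_iff_eq]
    split_ifs with h
    · exact Finset.sum_equiv e (fun c => by simp [Finset.mem_erase, e.injective.eq_iff])
        (fun c _ => rfl)
    · rfl
  have hprod' : ∏ i, (q ∘ e) i = if d % 4 = 1 then 2 * d else d := by
    rw [← hprod]; exact e.prod_comp (fun a => q a)
  have hq' : ∀ i, ((q ∘ e) i).Prime := fun i => hq (e i)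
  have hinj' : Function.Injective (q ∘ e) := hinj.comp e.injective
  have hd0 : d ≠ 0 := by
    rintro rfl
    have h0 : ∏ a, q a ≠ 0 := Finset.prod_ne_zero_iff.mpr fun a _ => (hq a).ne_zero
    simp at hprod
    exact h0 hprod
  rw [odd_genusClassNumber_iff_of_redeiReichardt hR hq' hinj' hprod' (GenusField d)
    (isQuadraticFieldOfSqrt_genusField (Nat.one_le_iff_ne_zero.mpr hd0))]
  have hker := card_ker_mulVec_eq (redeiMatrix d (q ∘ e))
  have hrk := rank_redeiMatrix_le d (q ∘ e) (pos_of_prod_eq hprod')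
  -- kernels on `ι` and on `Fin t` correspond under `v ↦ v ∘ e`
  have hiff : ∀ v : ι → ZMod 2, R *ᵥ v = 0 ↔ redeiMatrix d (q ∘ e) *ᵥ (v ∘ e) = 0 := by
    intro v
    have hv : (v ∘ ⇑e) ∘ ⇑e.symm = v := by ext a; simp
    rw [hsub, Matrix.submatrix_mulVec_equiv, hv]
    constructor
    · intro h; ext i; simp [h]
    · intro h; ext a
      have := congr_fun h (e.symm a)
      simpa using this
  have hcardι : Fintype.card {v : ι → ZMod 2 // R *ᵥ v = 0} =
      Fintype.card {w : Fin (Fintype.card ι) → ZMod 2 // redeiMatrix d (q ∘ e) *ᵥ w = 0} := by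
    refine Fintype.card_congr ⟨fun v => ⟨v.1 ∘ e, (hiff v.1).mp v.2⟩,
      fun w => ⟨w.1 ∘ e.symm, (hiff _).mpr ?_⟩, fun v => ?_, fun w => ?_⟩
    · have hw : (w.1 ∘ ⇑e.symm) ∘ ⇑e = w.1 := by ext i; simp
      rw [hw]; exact w.2
    · ext a; simp
    · ext i; simp
  rw [hcardι, hker]
  have ht : Fintype.card ι - (redeiMatrix d (q ∘ e)).rank =
      (Fintype.card ι - 1 - (redeiMatrix d (q ∘ e)).rank) + 1 := by
    have := pos_of_prod_eq hprod'
    omega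
  rw [ht, pow_succ]
  constructor
  · intro h; rw [h]; rfl
  · intro h
    by_contra hne
    have : 2 ≤ 2 ^ (Fintype.card ι - 1 - (redeiMatrix d (q ∘ e)).rank) := le_self_pow₀ (by norm_num) hne
    omega

/-! ## §2 `g(d) mod 2` of a divisor `d ∣ p₁⋯p_k` as a closed `0/1` term; the genus sums in decidable form -/

variable {k : ℕ} (p : Fin k → ℕ)

/-- For distinct primes `p₁, …, p_k` and `d ∣ p₁⋯p_k`, `d` is the product of the `pᵢ` dividing it.
[cite: HardyWright2008, §17.8 (square-free numbers)] -/
theorem prod_subtype_dvd_eq (hp : ∀ i, (p i).Prime) (hinj : Function.Injective p) {d : ℕ}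
    (hd : d ∣ ∏ i, p i) : ∏ a : {i : Fin k // p i ∣ d}, p a.1 = d := by
  have hsq : Squarefree d :=
    Squarefree.squarefree_of_dvd hd (squarefree_prod_of_injective p hp hinj)
  have himg : (univ.filter fun i => p i ∣ d).image p = d.primeFactors := by
    ext r
    simp only [Finset.mem_image, Finset.mem_filter, Finset.mem_univ, true_and,
      Nat.mem_primeFactors_of_ne_zero hsq.ne_zero]
    constructor
    · rintro ⟨i, hi, rfl⟩; exact ⟨hp i, hi⟩
    · rintro ⟨hr, hrd⟩
      obtain ⟨i, -, hi⟩ := ((Nat.Prime.prime hr).dvd_finsetProd_iff _).mp (hrd.trans hd)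
      exact ⟨i, ((Nat.prime_dvd_prime_iff_eq hr (hp i)).mp hi) ▸ hrd,
        ((Nat.prime_dvd_prime_iff_eq hr (hp i)).mp hi).symm⟩
  calc ∏ a : {i : Fin k // p i ∣ d}, p a.1 = ∏ i ∈ univ.filter (fun i => p i ∣ d), p i :=
        (Finset.prod_subtype (univ.filter fun i => p i ∣ d) (p := fun i => p i ∣ d)
          (fun i => by simp) (fun i => p i)).symm
    _ = ∏ r ∈ (univ.filter fun i => p i ∣ d).image p, r := by
        rw [Finset.prod_image fun i _ j _ h => hinj h]
    _ = d := by rw [himg, Nat.prod_primeFactors_of_squarefree hsq]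

/-- **`g(d) mod 2` of a divisor `d` of `n = p₁⋯p_k`, KERNEL-DECIDABLY** (modulo Rédei–Reichardt): the
Rédei matrix of `ℚ(√−d)` on the index type `{i // pᵢ ∣ d}` — with an extra vertex `2` (`Option`,
`none ↦ 2`) when `d ≡ 1 (mod 4)`, i.e. `D = −4d` — has a `2`-element kernel iff `g(d)` is odd; as a
`0/1`-valued function of `d` built from the instance's prime tuple `p` alone, so that the genus sums
of Tian–Yuan–Zhang evaluate by `decide`. [cite: LiMa2008, Thm. 0.4 with Lemma 0.1 (p. 279: D = D₁⋯D_t, p₁ = 2 iff 2 ∣ D)] [cite: TianYuanZhang2017, §1 (p0002 L78–L82)] -/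
theorem genusClassNumber_genusField_mod_two_eq (hR : redeiReichardt_fourTwoCard_classGroup)
    (hp : ∀ i, (p i).Prime) (hinj : Function.Injective p) {d : ℕ} (hd : d ∣ ∏ i, p i) :
    genusClassNumber (GenusField d) % 2 =
      if d % 4 = 1 then
        (if Fintype.card {v : Option {i : Fin k // p i ∣ d} → ZMod 2 //
          (Matrix.of fun a b : Option {i : Fin k // p i ∣ d} =>
            if a = b then ∑ c ∈ univ.erase a,
              kroneckerBit (primeDisc d (c.elim 2 fun i => p i.1)) (a.elim 2 fun i => p i.1)
            else kroneckerBit (primeDisc d (b.elim 2 fun i => p i.1)) (a.elim 2 fun i => p i.1))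
            *ᵥ v = 0} = 2 then 1 else 0)
      else
        (if Fintype.card {v : {i : Fin k // p i ∣ d} → ZMod 2 //
          (Matrix.of fun a b : {i : Fin k // p i ∣ d} =>
            if a = b then ∑ c ∈ univ.erase a, kroneckerBit (primeDisc d (p c.1)) (p a.1)
            else kroneckerBit (primeDisc d (p b.1)) (p a.1)) *ᵥ v = 0} = 2 then 1 else 0) := by
  have hdprod := prod_subtype_dvd_eq p hp hinj hd
  have hsqn : Squarefree (∏ i, p i) := squarefree_prod_of_injective p hp hinj
  have hd0 : d ≠ 0 := (Squarefree.squarefree_of_dvd hd hsqn).ne_zero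
  -- parity from an `iff` with a kernel count
  have key : ∀ {P : Prop} [Decidable P], (Odd (genusClassNumber (GenusField d)) ↔ P) →
      genusClassNumber (GenusField d) % 2 = if P then 1 else 0 := by
    intro P _ h
    by_cases hP : P
    · rw [if_pos hP]; exact Nat.odd_iff.mp (h.mpr hP)
    · rw [if_neg hP]; exact Nat.even_iff.mp (Nat.not_odd_iff_even.mp fun ho => hP (h.mp ho))
  by_cases h4 : d % 4 = 1
  · -- `d ≡ 1 (mod 4)`: primes of `D = −4d` are `2` and the `pᵢ ∣ d`
    rw [if_pos h4]
    refine key (odd_genusClassNumber_genusField_iff_card_ker hR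
      (fun o : Option {i : Fin k // p i ∣ d} => o.elim 2 fun i => p i.1) ?_ ?_ ?_)
    · rintro (_ | a)
      · exact Nat.prime_two
      · exact hp a.1
    · rintro (_ | a) (_ | b) h
      · rfl
      · exfalso
        have h2 : p b.1 = 2 := by simpa using h.symm
        have : (2 : ℕ) ∣ d := h2 ▸ b.2
        omega
      · exfalso
        have h2 : p a.1 = 2 := by simpa using h
        have : (2 : ℕ) ∣ d := h2 ▸ a.2
        omega
      · simp only [Option.elim_some] at h
        exact congrArg some (Subtype.ext (hinj h))
    · rw [if_pos h4, Fintype.prod_option]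
      simp only [Option.elim_none, Option.elim_some]
      rw [hdprod]
  · rw [if_neg h4]
    refine key (odd_genusClassNumber_genusField_iff_card_ker hR
      (fun a : {i : Fin k // p i ∣ d} => p a.1) (fun a => hp a.1)
      (fun a b h => Subtype.ext (hinj h)) ?_)
    rw [if_neg h4, hdprod]

/-- **The genus hypothesis of TYZ Thm 1.2 in DECIDABLE form.** For `n = p₁⋯p_k` (distinct primes),
`Σ₁` resp. `Σ₂` over the concrete genus fields `K_d = GenusField d` is odd iff the same sum of the
`0/1` Rédei bits of `genusClassNumber_genusField_mod_two_eq` is odd — the right-hand sides evaluate by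
`decide`. (Parity transfer `odd_genusSum₁/₂_iff_of_mod_two_eq`.) [cite: TianYuanZhang2017, Thm. 1.2 (Σ₁, Σ₂)] [cite: LiMa2008, Thm. 0.4] -/
theorem odd_genusSum_genusField_iff (hR : redeiReichardt_fourTwoCard_classGroup)
    (hp : ∀ i, (p i).Prime) (hinj : Function.Injective p) {n : ℕ} (hn : ∏ i, p i = n) :
    (Odd (genusSum₁ n fun d => genusClassNumber (GenusField d)) ↔
      Odd (genusSum₁ n fun d =>
        if d % 4 = 1 then
          (if Fintype.card {v : Option {i : Fin k // p i ∣ d} → ZMod 2 //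
            (Matrix.of fun a b : Option {i : Fin k // p i ∣ d} =>
              if a = b then ∑ c ∈ univ.erase a,
                kroneckerBit (primeDisc d (c.elim 2 fun i => p i.1)) (a.elim 2 fun i => p i.1)
              else kroneckerBit (primeDisc d (b.elim 2 fun i => p i.1)) (a.elim 2 fun i => p i.1))
              *ᵥ v = 0} = 2 then 1 else 0)
        else
          (if Fintype.card {v : {i : Fin k // p i ∣ d} → ZMod 2 //
            (Matrix.of fun a b : {i : Fin k // p i ∣ d} =>
              if a = b then ∑ c ∈ univ.erase a, kroneckerBit (primeDisc d (p c.1)) (p a.1)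
              else kroneckerBit (primeDisc d (p b.1)) (p a.1)) *ᵥ v = 0} = 2 then 1 else 0))) ∧
    (Odd (genusSum₂ n fun d => genusClassNumber (GenusField d)) ↔
      Odd (genusSum₂ n fun d =>
        if d % 4 = 1 then
          (if Fintype.card {v : Option {i : Fin k // p i ∣ d} → ZMod 2 //
            (Matrix.of fun a b : Option {i : Fin k // p i ∣ d} =>
              if a = b then ∑ c ∈ univ.erase a,
                kroneckerBit (primeDisc d (c.elim 2 fun i => p i.1)) (a.elim 2 fun i => p i.1)
              else kroneckerBit (primeDisc d (b.elim 2 fun i => p i.1)) (a.elim 2 fun i => p i.1))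
              *ᵥ v = 0} = 2 then 1 else 0)
        else
          (if Fintype.card {v : {i : Fin k // p i ∣ d} → ZMod 2 //
            (Matrix.of fun a b : {i : Fin k // p i ∣ d} =>
              if a = b then ∑ c ∈ univ.erase a, kroneckerBit (primeDisc d (p c.1)) (p a.1)
              else kroneckerBit (primeDisc d (p b.1)) (p a.1)) *ᵥ v = 0} = 2 then 1 else 0))) := by
  refine ⟨odd_genusSum₁_iff_of_mod_two_eq n ?_, odd_genusSum₂_iff_of_mod_two_eq n ?_⟩ <;>
  · intro d hd _
    rw [genusClassNumber_genusField_mod_two_eq p hR hp hinj (hn ▸ Nat.dvd_of_mem_divisors hd)]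
    split_ifs <;> rfl

end GenusSide


/-! ## §3 RE-KEY (APPEND-ONLY, p2-typer GEN 4, ruling T-81 / T-84): the PRINTED second sum `Σ₂'` decidable

ERRATUM F-Σ2 (`TianYuanZhang2017/GenusPeriodsParity.lean` §5): the printed second genus sum is
`genusSum₂'` (it includes the `ℓ = 0` term `{n}`); the corrected fact `thm12_parity_of_scriptL'` asks for
`Σ₁` odd or `Σ₂'` odd.  The twin below transfers the parity of `Σ₂'` over `GenusField` to the same
decidable `0/1` Rédei bits (lit-1's `odd_genusSum₂'_iff_of_mod_two_eq`), so that an instance keyed to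
the printed theorem is again ONE `decide +kernel`. -/

section GenusSidePrinted

variable {k : ℕ} (p : Fin k → ℕ)

/-- **The PRINTED second genus sum `Σ₂'` in DECIDABLE form** (twin of the `Σ₂` clause of
`odd_genusSum_genusField_iff`): for `n = p₁⋯p_k` (distinct primes), `Σ₂'` over `K_d = GenusField d` is
odd iff the same sum of the `0/1` Rédei bits is odd — the right-hand side evaluates by `decide +kernel`.
[cite: TianYuanZhang2017, Thm. 1.2 (Σ₂); proof of Prop. 3.4 (p0016 L146: the ℓ = 0 term)] [cite: LiMa2008, Thm. 0.4] -/
theorem odd_genusSum₂'_genusField_iff (hR : redeiReichardt_fourTwoCard_classGroup)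
    (hp : ∀ i, (p i).Prime) (hinj : Function.Injective p) {n : ℕ} (hn : ∏ i, p i = n) :
    (Odd (genusSum₂' n fun d => genusClassNumber (GenusField d)) ↔
      Odd (genusSum₂' n fun d =>
        if d % 4 = 1 then
          (if Fintype.card {v : Option {i : Fin k // p i ∣ d} → ZMod 2 //
            (Matrix.of fun a b : Option {i : Fin k // p i ∣ d} =>
              if a = b then ∑ c ∈ univ.erase a,
                kroneckerBit (primeDisc d (c.elim 2 fun i => p i.1)) (a.elim 2 fun i => p i.1)
              else kroneckerBit (primeDisc d (b.elim 2 fun i => p i.1)) (a.elim 2 fun i => p i.1))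
              *ᵥ v = 0} = 2 then 1 else 0)
        else
          (if Fintype.card {v : {i : Fin k // p i ∣ d} → ZMod 2 //
            (Matrix.of fun a b : {i : Fin k // p i ∣ d} =>
              if a = b then ∑ c ∈ univ.erase a, kroneckerBit (primeDisc d (p c.1)) (p a.1)
              else kroneckerBit (primeDisc d (p b.1)) (p a.1)) *ᵥ v = 0} = 2 then 1 else 0))) := by
  refine odd_genusSum₂'_iff_of_mod_two_eq n ?_
  intro d hd _
  rw [genusClassNumber_genusField_mod_two_eq p hR hp hinj (hn ▸ Nat.dvd_of_mem_divisors hd)]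
  split_ifs <;> rfl

end GenusSidePrinted

end Summit.BirchSwinnertonDyer.Rank1Residual.P2

end

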